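import Summits.AtomisticToContinuum.BoseEinsteinCondensation.Theorems.BECGroundStateSOSPeriodicIRBoundTwoSectorDefs
import Summits.AtomisticToContinuum.BoseEinsteinCondensation.Theorems.PeriodicIRBound.Negative.TwoModeStates
import HarnessLib

/-!
# Route `BECGroundStateSOS`, crux `PeriodicIRBound` (stmt-AtomisticToContinuum-3972), line `two-sector-gd-transfer` —
# the free-gas constant of the pooled stub S1 (`GaussianDomination`, stmt-12620) is PINNED: `GDFor 0 K ρ₀ C → 1/(4π²) ≤ C`

Supports (does not close) stmt-AtomisticToContinuum-3972. Companion of `…TwoSectorFreeGas.lean` (`gdFor_zero`: the free gas satisfies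
the body of stmt-12620 with every `C ≥ 1/(4π²)`). Here the converse: for `K, ρ₀, C > 0`, `GDFor 0 K ρ₀ C` forces `C ≥ 1/(4π²)` — the
two-sector susceptibility of the FREE gas at the first shell `n = e₀` is exactly `1/ε_{e₀} = L²/(4π²)`, and it is saturated by the coherent
product family `Ψ = φ₀^{⊗N}`, `Φ_s = (√(1−s)·φ₀ + √s·φ_{e₀})^{⊗(N+1)}` (`GaussianDominationCan.Negative.symState`) as `s → 0`, `p → 1`,
`t → 0⁻`. So at `v = 0` the typed Gaussian domination is sharp with `C = 1/(4π²)` (sup-norm normalisation): unlike the crux, whose constant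
is unconstrained without interaction (`Negative.irBoundWith_zero`: every `C > 0`), stmt-12620 carries interaction-free content, and the
strengthening "`GDFor v K ρ₀ C` for EVERY `C > 0`" is refuted already by the free gas (`not_gdFor_zero_small`).

* §1 `integral_conj_oneBody_mul_oneBody` (`∫_cell conj(a₀ + b₀e_n)(a + b e_n) = L³(a₀a + b₀b)`), `transfer_symState` (the one-particle
  transfer integral of stmt-12620 between two coherent product states: `I(φ^{⊗N}, χ^{⊗(N+1)}) = b√(L³)·(L³(a₀a + b₀b))^N`).
* §2 `gdFor_zero_sharp`, `not_gdFor_zero_small`.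

References: F. J. Dyson, E. H. Lieb, B. Simon, J. Stat. Phys. 18 (1978) 335, §1; T. Kennedy, E. H. Lieb, B. S. Shastry, J. Stat. Phys. 53
(1988) 1019, (12)–(14) (the susceptibility read off Gaussian domination; free bosons saturate it).
-/

noncomputable section

open scoped BigOperators ENNReal ComplexConjugate
open Filter MeasureTheory

namespace Summit.AtomisticToContinuum.BoseEinsteinCondensation.Cruxes.PeriodicIRBound.TwoSectorGdTransfer

open Literature.MathematicalPhysics.QuantumManyBody.BoseGas
open Summit.AtomisticToContinuum.BoseEinsteinCondensation.Theorems.GaussianDominationCan.Negative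
  (symState symFun oneBody periodicEnergy_symState nsq nsq_nonneg e0 e0_ne_zero norm_e0 nsq_e0
    continuous_oneBody integral_cell_const conj_cellWave_mul_self integral_cell_conj_cellWave integral_cellN_prod)
open Summit.AtomisticToContinuum.BoseEinsteinCondensation.Theorems.GaussianDominationCan.Negative
  renaming prodFun → gdProd
open Summit.AtomisticToContinuum.BoseEinsteinCondensation.Theorems.PeriodicIRBound.Negative
  (symFun_vecCons integral_conj_planeWaveMode_mul_oneBody)

namespace FreeGas

variable {L : ℝ} {n : Fin 3 → ℤ}

/-! ## §1 The transfer integral between two coherent product states -/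

/-- `∫_cell conj(a₀ + b₀ e_n)·(a + b e_n) = L³ (a₀ a + b₀ b)` for `n ≠ 0` (orthogonality of `1, e_n` on the cell). [folklore] -/
theorem integral_conj_oneBody_mul_oneBody (hL : 0 < L) (hn : n ≠ 0) (a₀ b₀ a b : ℝ) :
    ∫ x in cell L, conj (oneBody L n a₀ b₀ x) * oneBody L n a b x = ((L ^ 3 * (a₀ * a + b₀ * b) : ℝ) : ℂ) := by
  have h : ∀ x, conj (oneBody L n a₀ b₀ x) * oneBody L n a b x =
      ((a₀ * a + b₀ * b : ℝ) : ℂ) + (((a₀ * b : ℝ) : ℂ) * cellWave L n x +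
        ((b₀ * a : ℝ) : ℂ) * conj (cellWave L n x)) := by
    intro x
    simp only [oneBody, map_add, map_mul, Complex.conj_ofReal]
    have := conj_cellWave_mul_self L n x
    push_cast
    linear_combination ((b₀ : ℂ) * (b : ℂ)) * this
  simp_rw [h]
  have hA : IntegrableOn (fun _ : Space => ((a₀ * a + b₀ * b : ℝ) : ℂ)) (cell L) :=
    integrableOn_cell (f := fun _ => ((a₀ * a + b₀ * b : ℝ) : ℂ)) continuous_const
  have hB : IntegrableOn (fun x : Space => ((a₀ * b : ℝ) : ℂ) * cellWave L n x) (cell L) :=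
    integrableOn_cell (f := fun x => ((a₀ * b : ℝ) : ℂ) * cellWave L n x) (by fun_prop)
  have hC : IntegrableOn (fun x : Space => ((b₀ * a : ℝ) : ℂ) * conj (cellWave L n x)) (cell L) :=
    integrableOn_cell (f := fun x => ((b₀ * a : ℝ) : ℂ) * conj (cellWave L n x)) (by fun_prop)
  have hBC : IntegrableOn (fun x : Space => ((a₀ * b : ℝ) : ℂ) * cellWave L n x +
      ((b₀ * a : ℝ) : ℂ) * conj (cellWave L n x)) (cell L) := hB.add hC
  rw [integral_add hA hBC, integral_add hB hC, integral_cell_const hL, integral_const_mul,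
    integral_const_mul, integral_cell_cellWave_eq_zero hL hn, integral_cell_conj_cellWave hL hn, mul_zero, mul_zero,
    add_zero, add_zero]
  push_cast
  ring

/-- **Transfer integral of coherent product states**: for `Ψ = (a₀ + b₀e_n)^{⊗(m+1)}` and `Φ = (a + b e_n)^{⊗(m+2)}` (`symState`),
`I(Ψ,Φ) = Re ∫ conj Ψ(Y) ∫ conj(L^{-3/2}e_n(x)) Φ(x,Y) dx dY = b√(L³) · (L³(a₀a + b₀b))^{m+1}` (slice `Φ(x,Y) = χ(x)χ^{⊗(m+1)}(Y)`,
`∫ conj(φ_n)χ = b√(L³)`, Fubini on `cell^{m+1}`). [cite: LSSY2005, App. A (A.13)] -/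
theorem transfer_symState (hL : 0 < L) (hn : n ≠ 0) (m : ℕ) (a₀ b₀ a b : ℝ) (h₀ : (a₀ ^ 2 + b₀ ^ 2) * L ^ 3 = 1)
    (hab : (a ^ 2 + b ^ 2) * L ^ 3 = 1) :
    transferIntegralRe L n (symState m hL hn a₀ b₀ h₀).ψ (symState (m + 1) hL hn a b hab).ψ =
      b * Real.sqrt (L ^ 3) * (L ^ 3 * (a₀ * a + b₀ * b)) ^ (m + 1) := by
  unfold transferIntegralRe
  show (∫ Y in cellN (m + 1) L, conj (symFun m L n a₀ b₀ Y) *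
      ∫ x in cell L, conj (((Real.sqrt (L ^ 3))⁻¹ : ℂ) * cellWave L n x) *
        symFun (m + 1) L n a b (Matrix.vecCons x Y)).re = _
  have hmode : ∀ x, conj (((Real.sqrt (L ^ 3))⁻¹ : ℂ) * cellWave L n x) = conj (planeWaveMode L n x) := fun x => by
    rw [planeWaveMode_eq]
  simp_rw [hmode]
  have hinner : ∀ Y : Config (m + 1),
      ∫ x in cell L, conj (planeWaveMode L n x) * symFun (m + 1) L n a b (Matrix.vecCons x Y) =
        ((b * Real.sqrt (L ^ 3) : ℝ) : ℂ) * gdProd (fun _ : Fin (m + 1) => oneBody L n a b) Y := by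
    intro Y
    simp_rw [symFun_vecCons, ← mul_assoc]
    rw [integral_mul_const, integral_conj_planeWaveMode_mul_oneBody hL hn]
  simp_rw [hinner]
  have hprod : ∀ Y : Config (m + 1),
      conj (symFun m L n a₀ b₀ Y) * (((b * Real.sqrt (L ^ 3) : ℝ) : ℂ) * gdProd (fun _ : Fin (m + 1) => oneBody L n a b) Y) =
        ((b * Real.sqrt (L ^ 3) : ℝ) : ℂ) * ∏ i : Fin (m + 1), (conj (oneBody L n a₀ b₀ (Y i)) * oneBody L n a b (Y i)) := by
    intro Y
    simp only [symFun, Theorems.GaussianDominationCan.Negative.prodFun, map_prod, Finset.prod_mul_distrib]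
    ring
  simp_rw [hprod]
  rw [integral_const_mul]
  have hF := integral_cellN_prod (L := L) (fun _ : Fin (m + 1) => fun y => conj (oneBody L n a₀ b₀ y) * oneBody L n a b y)
  rw [hF]
  simp_rw [integral_conj_oneBody_mul_oneBody hL hn]
  rw [Finset.prod_const, Finset.card_univ, Fintype.card_fin, ← Complex.ofReal_pow, ← Complex.ofReal_mul, Complex.ofReal_re]

/-- `E(χ^{⊗(m+1)})` at `v = 0` over `ℝ`: `(m+1)·(b²L³)·4π²|n|²/L²` (`periodicEnergy_symState`). [folklore] -/
theorem toReal_periodicEnergy_symState (hL : 0 < L) (hn : n ≠ 0) {m : ℕ} {a b : ℝ} (hab : (a ^ 2 + b ^ 2) * L ^ 3 = 1) :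
    (periodicEnergy 0 (symState m hL hn a b hab)).toReal =
      ((m + 1 : ℕ) : ℝ) * ((b ^ 2 * L ^ 3) * (4 * Real.pi ^ 2 * nsq n / L ^ 2)) := by
  rw [periodicEnergy_symState hL hn hab, ENNReal.toReal_ofReal]
  have : 0 ≤ nsq n := nsq_nonneg n
  positivity

/-! ## §2 The free-gas constant is pinned: `GDFor 0 K ρ₀ C → 1/(4π²) ≤ C` -/

/-- **Sharpness of S1 at `v = 0`.** If `K, ρ₀, C > 0` and the free gas satisfies the body of stmt-12620 with data `(K, ρ₀, C)`, then
`C ≥ 1/(4π²)`. Proof: at an eventually-large `N`, a side `L ≥ 1` with `(N+1) ≤ ρ₀L³` and `2π/L ≤ K`, and the first shell `n = e₀`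
(`|n|₂ = ‖n‖_∞ = 1`), test the inequality on `Ψ = φ₀^{⊗N}`, `Φ = (√(1−s)φ₀ + √s φ_{e₀})^{⊗(N+1)}`: `E(Ψ) = 0`, `E(Φ) = (N+1)s·4π²/L²`,
`√(N+1)·I = √(N+1)√s(1−s)^{N/2}`; at `p` close to `1` (so that the optimal `|t| = √(p(1−p))·√(N+1)I/(CL²) ≤ t₀`) the discriminant gives
`4π²C ≥ p(1−s)^N`, and `s → 0`, `p → 1` (Bernoulli) contradict `4π²C < 1`. [cite: DLS1978, §1] -/
theorem gdFor_zero_sharp {K ρ₀ C : ℝ} (hK : 0 < K) (hρ₀ : 0 < ρ₀) (hC : 0 < C) (h : GDFor 0 K ρ₀ C) :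
    1 / (4 * Real.pi ^ 2) ≤ C := by
  have hπ : (0 : ℝ) < 4 * Real.pi ^ 2 := by positivity
  by_contra hle
  have hlt : C < 1 / (4 * Real.pi ^ 2) := not_le.mp hle
  -- `η := 1 − 4π²C ∈ (0, 1)`
  set η : ℝ := 1 - 4 * Real.pi ^ 2 * C with hηdef
  have hη0 : 0 < η := by
    have : 4 * Real.pi ^ 2 * C < 1 := by
      have := (lt_div_iff₀ hπ).1 hlt
      linarith
    linarith
  have hη1 : η < 1 := by
    have : 0 < 4 * Real.pi ^ 2 * C := mul_pos hπ hC
    linarith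
  -- an eventually-large particle number `N = N₀ + 1`
  obtain ⟨N₀, hN₀⟩ := Filter.eventually_atTop.1 h
  have hN := hN₀ (N₀ + 1) (Nat.le_succ _)
  set Np : ℝ := (N₀ : ℝ) + 2 with hNpdef
  have hNp : 0 < Np := by positivity
  have hcastN : ((N₀ + 1 : ℕ) : ℝ) + 1 = Np := by push_cast; ring
  -- the side `L`
  set L : ℝ := Np / ρ₀ + 2 * Real.pi / K + 1 with hLdef
  have hL1 : 1 ≤ L := by
    have h1 : 0 ≤ Np / ρ₀ := div_nonneg hNp.le hρ₀.le
    have h2 : 0 ≤ 2 * Real.pi / K := by positivity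
    linarith
  have hL : 0 < L := by linarith
  have hdens : ((N₀ + 1 : ℕ) : ℝ) + 1 ≤ ρ₀ * L ^ 3 := by
    rw [hcastN]
    have h2 : 0 ≤ 2 * Real.pi / K := by positivity
    have hLNp : Np / ρ₀ ≤ L := by linarith
    have hNpL : Np ≤ ρ₀ * L := by
      have := mul_le_mul_of_nonneg_left hLNp hρ₀.le
      rwa [mul_div_cancel₀ _ hρ₀.ne'] at this
    have hLL : L ≤ L ^ 3 := by
      calc L = L * 1 * 1 := by ring
        _ ≤ L * L * L := by gcongr
        _ = L ^ 3 := by ring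
    calc Np ≤ ρ₀ * L := hNpL
      _ ≤ ρ₀ * L ^ 3 := mul_le_mul_of_nonneg_left hLL hρ₀.le
  have hwin : 2 * Real.pi / L * ‖(fun j => ((e0 j : ℤ) : ℝ))‖ ≤ K := by
    rw [norm_e0, mul_one, div_le_iff₀ hL]
    have h1 : 0 ≤ Np / ρ₀ := div_nonneg hNp.le hρ₀.le
    have hKL : 2 * Real.pi / K ≤ L := by linarith
    have := mul_le_mul_of_nonneg_left hKL hK.le
    rw [mul_div_cancel₀ _ hK.ne'] at this
    linarith [this]
  obtain ⟨t₀, ht₀, hGD⟩ := hN L hL hdens e0 e0_ne_zero hwin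
  -- the coherent fraction `s` and the weight `p`
  set s : ℝ := η / (2 * Np) with hsdef
  have hs0 : 0 < s := div_pos hη0 (by positivity)
  have hs1 : s ≤ 1 / 4 := by
    rw [hsdef, div_le_iff₀ (by positivity)]
    have : (2 : ℝ) ≤ Np := by rw [hNpdef]; linarith [(Nat.cast_nonneg N₀ : (0 : ℝ) ≤ N₀)]
    nlinarith
  have hbern : 1 - η / 2 ≤ (1 - s) ^ (N₀ + 1) := by
    have hb := one_add_mul_le_pow (show (-2 : ℝ) ≤ -s by linarith) (N₀ + 1)
    have hNs : ((N₀ + 1 : ℕ) : ℝ) * s ≤ η / 2 := by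
      have hle : ((N₀ + 1 : ℕ) : ℝ) ≤ Np := by push_cast; linarith
      calc ((N₀ + 1 : ℕ) : ℝ) * s ≤ Np * s := mul_le_mul_of_nonneg_right hle hs0.le
        _ = η / 2 := by rw [hsdef]; field_simp
    calc 1 - η / 2 ≤ 1 + ((N₀ + 1 : ℕ) : ℝ) * (-s) := by linarith
      _ ≤ (1 + (-s)) ^ (N₀ + 1) := hb
      _ = (1 - s) ^ (N₀ + 1) := by ring
  set p : ℝ := max (1 - η / 4) (1 - (C * L ^ 2 * t₀) ^ 2 / Np) with hpdef
  have hpη : 1 - η / 4 ≤ p := le_max_left _ _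
  have hp0 : 0 ≤ p := le_trans (by linarith) hpη
  have hp1 : p < 1 := by
    rw [hpdef, max_lt_iff]
    refine ⟨by linarith, ?_⟩
    have : 0 < (C * L ^ 2 * t₀) ^ 2 / Np := div_pos (by positivity) hNp
    linarith
  have h1p : 0 < 1 - p := by linarith
  have h1pN : (1 - p) * Np ≤ (C * L ^ 2 * t₀) ^ 2 := by
    have : 1 - (C * L ^ 2 * t₀) ^ 2 / Np ≤ p := le_max_right _ _
    have h2 : 1 - p ≤ (C * L ^ 2 * t₀) ^ 2 / Np := by linarith
    have := mul_le_mul_of_nonneg_right h2 hNp.le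
    rwa [div_mul_cancel₀ _ hNp.ne'] at this
  -- the states
  have hL3 : 0 < L ^ 3 := by positivity
  set r : ℝ := (Real.sqrt (L ^ 3))⁻¹ with hrdef
  have hr2 : r ^ 2 * L ^ 3 = 1 := by
    rw [hrdef, inv_pow, Real.sq_sqrt hL3.le, inv_mul_cancel₀ hL3.ne']
  set c : ℝ := Real.sqrt (1 - s) with hcdef
  set d : ℝ := Real.sqrt s with hddef
  have hc2 : c ^ 2 = 1 - s := Real.sq_sqrt (by linarith)
  have hd2 : d ^ 2 = s := Real.sq_sqrt hs0.le
  have hc0 : 0 ≤ c := Real.sqrt_nonneg _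
  have hd0 : 0 ≤ d := Real.sqrt_nonneg _
  have hc1 : c ≤ 1 := by rw [hcdef, Real.sqrt_le_one]; linarith
  have hd1 : d ≤ 1 := by rw [hddef, Real.sqrt_le_one]; linarith
  have h₀ : (r ^ 2 + (0 : ℝ) ^ 2) * L ^ 3 = 1 := by rw [zero_pow two_ne_zero, add_zero, hr2]
  have hab : ((c * r) ^ 2 + (d * r) ^ 2) * L ^ 3 = 1 := by
    calc ((c * r) ^ 2 + (d * r) ^ 2) * L ^ 3 = (c ^ 2 + d ^ 2) * (r ^ 2 * L ^ 3) := by ring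
      _ = 1 := by rw [hc2, hd2, hr2]; ring
  set Ψ := symState N₀ hL e0_ne_zero r 0 h₀ with hΨdef
  set Φ := symState (N₀ + 1) hL e0_ne_zero (c * r) (d * r) hab with hΦdef
  -- their energies and the transfer integral
  have hEΨ : (periodicEnergy 0 Ψ).toReal = 0 := by
    rw [hΨdef, toReal_periodicEnergy_symState hL e0_ne_zero h₀]
    ring
  have hEΦ : (periodicEnergy 0 Φ).toReal = Np * s * (4 * Real.pi ^ 2 / L ^ 2) := by
    rw [hΦdef, toReal_periodicEnergy_symState hL e0_ne_zero hab, nsq_e0]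
    have : (d * r) ^ 2 * L ^ 3 = s := by
      calc (d * r) ^ 2 * L ^ 3 = d ^ 2 * (r ^ 2 * L ^ 3) := by ring
        _ = s := by rw [hd2, hr2, mul_one]
    rw [this]
    push_cast
    rw [hNpdef]
    ring
  have hI : transferIntegralRe L e0 Ψ.ψ Φ.ψ = d * c ^ (N₀ + 1) := by
    rw [hΨdef, hΦdef, transfer_symState hL e0_ne_zero N₀ r 0 (c * r) (d * r) h₀ hab]
    have hrs : r * Real.sqrt (L ^ 3) = 1 := by rw [hrdef, inv_mul_cancel₀ (Real.sqrt_pos.2 hL3).ne']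
    have hin : L ^ 3 * (r * (c * r) + 0 * (d * r)) = c := by
      calc L ^ 3 * (r * (c * r) + 0 * (d * r)) = c * (r ^ 2 * L ^ 3) := by ring
        _ = c := by rw [hr2, mul_one]
    rw [hin]
    calc d * r * Real.sqrt (L ^ 3) * c ^ (N₀ + 1) = d * (r * Real.sqrt (L ^ 3)) * c ^ (N₀ + 1) := by ring
      _ = d * c ^ (N₀ + 1) := by rw [hrs, mul_one]
  have hfinΨ : periodicEnergy 0 Ψ ≠ ⊤ := by
    rw [hΨdef, periodicEnergy_symState hL e0_ne_zero h₀]; exact ENNReal.ofReal_ne_top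
  have hfinΦ : periodicEnergy 0 Φ ≠ ⊤ := by
    rw [hΦdef, periodicEnergy_symState hL e0_ne_zero hab]; exact ENNReal.ofReal_ne_top
  -- the test values `M = √(N+1)·I`, `c₁ = √(p(1−p))·M`, `t = −c₁/(CL²)`
  set M : ℝ := Real.sqrt Np * (d * c ^ (N₀ + 1)) with hMdef
  have hM0 : 0 ≤ M := by positivity
  have hMle : M ≤ Real.sqrt Np := by
    have hcN : c ^ (N₀ + 1) ≤ 1 := pow_le_one₀ hc0 hc1
    have : d * c ^ (N₀ + 1) ≤ 1 := by
      calc d * c ^ (N₀ + 1) ≤ 1 * 1 := mul_le_mul hd1 hcN (by positivity) zero_le_one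
        _ = 1 := one_mul 1
    calc M = Real.sqrt Np * (d * c ^ (N₀ + 1)) := rfl
      _ ≤ Real.sqrt Np * 1 := mul_le_mul_of_nonneg_left this (Real.sqrt_nonneg _)
      _ = Real.sqrt Np := mul_one _
  set σ : ℝ := Real.sqrt (p * (1 - p)) with hσdef
  have hσ0 : 0 ≤ σ := Real.sqrt_nonneg _
  have hσ2 : σ ^ 2 = p * (1 - p) := Real.sq_sqrt (mul_nonneg hp0 h1p.le)
  have hσle : σ ≤ Real.sqrt (1 - p) := by
    rw [hσdef]
    exact Real.sqrt_le_sqrt (mul_le_of_le_one_left h1p.le hp1.le)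
  set c₁ : ℝ := σ * M with hc₁def
  have hc₁0 : 0 ≤ c₁ := mul_nonneg hσ0 hM0
  have hCL : 0 < C * L ^ 2 := by positivity
  set τ : ℝ := c₁ / (C * L ^ 2) with hτdef
  have hτ0 : 0 ≤ τ := div_nonneg hc₁0 hCL.le
  have hτt₀ : τ ≤ t₀ := by
    rw [hτdef, div_le_iff₀ hCL]
    have h1 : c₁ ≤ Real.sqrt (1 - p) * Real.sqrt Np := mul_le_mul hσle hMle hM0 (Real.sqrt_nonneg _)
    have h2 : Real.sqrt (1 - p) * Real.sqrt Np = Real.sqrt ((1 - p) * Np) := (Real.sqrt_mul h1p.le Np).symm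
    have h3 : Real.sqrt ((1 - p) * Np) ≤ Real.sqrt ((C * L ^ 2 * t₀) ^ 2) := Real.sqrt_le_sqrt h1pN
    have h4 : Real.sqrt ((C * L ^ 2 * t₀) ^ 2) = C * L ^ 2 * t₀ := Real.sqrt_sq (by positivity)
    calc c₁ ≤ Real.sqrt ((1 - p) * Np) := h2 ▸ h1
      _ ≤ C * L ^ 2 * t₀ := h4 ▸ h3
      _ = t₀ * (C * L ^ 2) := by ring
  have ht : |(-τ)| ≤ t₀ := by rw [abs_neg, abs_of_nonneg hτ0]; exact hτt₀
  -- Gaussian domination tested at `(t, p, Ψ, Φ) = (−τ, p, φ₀^{⊗N}, Φ_s)`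
  have hineq := hGD (-τ) ht p hp0 hp1.le Ψ Φ hfinΨ hfinΦ
  have hlhs : p * (periodicGroundStateEnergy 0 (N₀ + 1) L).toReal +
        (1 - p) * (periodicGroundStateEnergy 0 (N₀ + 1 + 1) L).toReal -
      C * (-τ) ^ 2 * L ^ 2 / ‖(fun j => ((e0 j : ℤ) : ℝ))‖ ^ 2 = -(τ * c₁) := by
    rw [periodicGroundStateEnergy_zero_eq_zero _ hL, periodicGroundStateEnergy_zero_eq_zero _ hL, ENNReal.toReal_zero,
      norm_e0]
    have hτc : τ * (C * L ^ 2) = c₁ := by rw [hτdef, div_mul_cancel₀ _ hCL.ne']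
    calc p * 0 + (1 - p) * 0 - C * (-τ) ^ 2 * L ^ 2 / (1 : ℝ) ^ 2 = -(τ * (τ * (C * L ^ 2))) := by ring
      _ = -(τ * c₁) := by rw [hτc]
  have hrhs : p * (periodicEnergy 0 Ψ).toReal + (1 - p) * (periodicEnergy 0 Φ).toReal +
      2 * -τ * Real.sqrt (p * (1 - p)) * Real.sqrt (((N₀ + 1 : ℕ) : ℝ) + 1) * transferIntegralRe L e0 Ψ.ψ Φ.ψ =
        (1 - p) * (Np * s * (4 * Real.pi ^ 2 / L ^ 2)) - 2 * (τ * c₁) := by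
    rw [hEΨ, hEΦ, hI, hcastN, hc₁def, hMdef, hσdef]
    ring
  rw [hlhs, hrhs] at hineq
  -- `hineq : −τc₁ ≤ (1−p)·Np·s·4π²/L² − 2τc₁`, and `τc₁ = c₁²/(CL²)`, so `c₁² ≤ 4π²C·(1−p)·Np·s`
  have hkey : c₁ ^ 2 ≤ 4 * Real.pi ^ 2 * C * ((1 - p) * Np * s) := by
    have h2 : τ * c₁ ≤ (1 - p) * (Np * s * (4 * Real.pi ^ 2 / L ^ 2)) := by linarith only [hineq]
    have hτc : C * L ^ 2 * τ = c₁ := by rw [hτdef, mul_div_cancel₀ _ hCL.ne']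
    have h3 : c₁ ^ 2 = τ * c₁ * (C * L ^ 2) := by
      calc c₁ ^ 2 = (C * L ^ 2 * τ) * c₁ := by rw [hτc]; ring
        _ = τ * c₁ * (C * L ^ 2) := by ring
    have hL2 : L ^ 2 ≠ 0 := by positivity
    calc c₁ ^ 2 = τ * c₁ * (C * L ^ 2) := h3
      _ ≤ (1 - p) * (Np * s * (4 * Real.pi ^ 2 / L ^ 2)) * (C * L ^ 2) :=
          mul_le_mul_of_nonneg_right h2 hCL.le
      _ = 4 * Real.pi ^ 2 * C * ((1 - p) * Np * s) := by field_simp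
  -- `c₁² = p(1−p)·Np·s·(1−s)^{N₀+1}`; divide by `(1−p)·Np·s > 0`
  have hc₁sq : c₁ ^ 2 = p * (1 - s) ^ (N₀ + 1) * ((1 - p) * Np * s) := by
    have hNp2 : Real.sqrt Np ^ 2 = Np := Real.sq_sqrt hNp.le
    have hcpow : (c ^ (N₀ + 1)) ^ 2 = (1 - s) ^ (N₀ + 1) := by rw [← pow_mul, mul_comm, pow_mul, hc2]
    calc c₁ ^ 2 = σ ^ 2 * Real.sqrt Np ^ 2 * d ^ 2 * (c ^ (N₀ + 1)) ^ 2 := by rw [hc₁def, hMdef]; ring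
      _ = p * (1 - s) ^ (N₀ + 1) * ((1 - p) * Np * s) := by rw [hσ2, hNp2, hd2, hcpow]; ring
  have hpos : 0 < (1 - p) * Np * s := by positivity
  have hfinal : p * (1 - s) ^ (N₀ + 1) ≤ 4 * Real.pi ^ 2 * C := by
    rw [hc₁sq] at hkey
    exact le_of_mul_le_mul_right hkey hpos
  -- contradiction with `p ≥ 1 − η/4`, `(1−s)^{N₀+1} ≥ 1 − η/2`, `4π²C = 1 − η`
  have hCη : 4 * Real.pi ^ 2 * C = 1 - η := by rw [hηdef]; ring
  have hprod : (1 - η / 4) * (1 - η / 2) ≤ p * (1 - s) ^ (N₀ + 1) :=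
    mul_le_mul hpη hbern (by linarith) hp0
  have hsq : 0 ≤ η ^ 2 := sq_nonneg η
  nlinarith only [hprod, hfinal, hCη, hη0, hη1, hsq]

/-- **Refuted strengthening**: the free gas does NOT satisfy the body of stmt-12620 with a constant below `1/(4π²)` — "Gaussian
domination for every `C > 0`" is false already at `v = 0` (contrast: the crux holds at `v = 0` with every `C > 0`,
`Negative.irBoundWith_zero`). [cite: DLS1978, §1] -/
theorem not_gdFor_zero_small {K ρ₀ C : ℝ} (hK : 0 < K) (hρ₀ : 0 < ρ₀) (hC : 0 < C) (hlt : C < 1 / (4 * Real.pi ^ 2)) :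
    ¬ GDFor 0 K ρ₀ C := fun h =>
  absurd (gdFor_zero_sharp hK hρ₀ hC h) (not_le.2 hlt)

end FreeGas

/-- **Registered by-product stub `stub_freeGasGDSharp` of the crux ledger** (line `two-sector-gd-transfer`, lead seat c21): for
`K, ρ₀, C > 0`, the body of stmt-12620 on the free gas forces `C ≥ 1/(4π²)` (`FreeGas.gdFor_zero_sharp`). [cite: DLS1978, §1] -/
theorem stub_freeGasGDSharp : ∀ K ρ₀ C : ℝ, 0 < K → 0 < ρ₀ → 0 < C → Summit.AtomisticToContinuum.BoseEinsteinCondensation.Cruxes.PeriodicIRBound.TwoSectorGdTransfer.GDFor 0 K ρ₀ C → 1 / (4 * Real.pi ^ 2) ≤ C :=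
  fun _ _ _ hK hρ₀ hC h => FreeGas.gdFor_zero_sharp hK hρ₀ hC h

end Summit.AtomisticToContinuum.BoseEinsteinCondensation.Cruxes.PeriodicIRBound.TwoSectorGdTransfer

end
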